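import Summits.BirchSwinnertonDyer.BirchSwinnertonDyer.Theorems.ResidualThetaTransportAtTwoSignedMuSeedAtTwoPlusJetFrobeniusCollapse
import Mathlib.RingTheory.PowerSeries.Basic
import Mathlib.Tactic.LinearCombination
import HarnessLib

/-!
# The `ρ`-symmetrisation selector and the LEVEL-ZERO VALUATION DICHOTOMY `v(S₀) ∈ {0} ∪ [4, ∞)` of the seed line
# `jet-character-sums` (stub J3 `LevelZeroDichotomy`, algebraic core; crux `SignedMuSeedAtTwoPlus` stmt-BirchSwinnertonDyer-21438;
# Kμ⁺ stmt-BirchSwinnertonDyer-20689; route `ResidualThetaTransportAtTwo`)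

Cell `bsd-wall`, width seat `bsd-wall-rtt-p4-w2` (g12). THEOREMS ONLY (no `def`, no named fact, no `sorry`); helper `--supports` the
seed crux; nothing about any curve, unit or `μ`-invariant is asserted; BSD is not proved by this. The card
(`Cruxes/SignedMuSeedAtTwoPlus/Ideas/jet-character-sums.md`) reads the tilt series as `S₀ = Φ_ρ = λ Φ_χ∘[ζ₃] + λ² Φ_χ∘[ζ₃²]` and claims
the dichotomy «`v_t(S₀) ∈ {0} ∪ [4,∞)` with `NonDeg(0) ⟺ E₀ ≠ 0`», flagging a CONVENTION CAVEAT (which weight rides on which rotation).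
In a diagonalised model the rotation `[ζ₃]` acts on the parameter by `t ↦ ζ₃ t` (`PowerSeries.rescale`), so the symmetrisation is
pure coefficient algebra over a ring of characteristic `2` containing `λ` with `λ² + λ + 1 = 0`:

* `pow_three_eq_one_of_rho`, `rhoSelector_eq` — `λ³ = 1` and **`λ^{n+1} + λ^{2n+2} = [n ≢ 2 (mod 3)]`**; the mirror
  `rhoSelector'_eq` — `λ^{2n+1} + λ^{n+2} = [n ≢ 1 (mod 3)]`.
* `coeff_rhoSymm` / **`coeff_rhoSymm_eq`** — with `ζ₃ = λ`: `[tⁿ](λ Φ(λt) + λ² Φ(λ²t)) = [tⁿ]Φ` if `n ≢ 2 (mod 3)`, else `0`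
  (the symmetrisation KILLS the residues `n ≡ 2`); `coeff_rhoSymm'_eq` — with `ζ₃ = λ²` it kills `n ≡ 1` instead (the caveat, made exact).
* **`rhoSymm_levelZero_dichotomy`** — if `Φ` has the Lever-(i)/(ii) jets `[t⁰]Φ = E`, `[t¹]Φ = E²`, `[t³]Φ = E⁴` (card: `T₁ = E₀²`,
  `T₃ = E₀⁴`, kernel `…JetOrbitSum` / `…JetFrobeniusCollapse`), then for `S = λ Φ(λt) + λ² Φ(λ²t)`:
  `E ≠ 0 → [t⁰]S ≠ 0` (order `0`) and `E = 0 → X⁴ ∣ S` — **`v(S) ∈ {0} ∪ [4, ∞)`**, the card's level-zero dichotomy, CONDITIONAL only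
  on the diagonal convention `ζ₃ = λ`; `rhoSymm'_levelZero` records what the other convention gives (`[t¹]S′ = 0` always, `v(S′) ∈ {0} ∪ [2,∞)`).

References: the card (Lever, Consequences, Convention caveat); [SilvermanAEC2009] IV.1 for context only.
-/

set_option autoImplicit false
set_option linter.dupNamespace false

noncomputable section

open PowerSeries

namespace Summit.BirchSwinnertonDyer.BirchSwinnertonDyer.Theorems.SignedMuAtTwo.JetCharacterSums

variable {R : Type*} [CommRing R]

/-- `λ² + λ + 1 = 0 ⇒ λ³ = 1`. [folklore] -/
theorem pow_three_eq_one_of_rho {l : R} (hl : l ^ 2 + l + 1 = 0) : l ^ 3 = 1 := by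
  linear_combination (l - 1) * hl

variable [CharP R 2]

/-- **The selector of the `ρ`-symmetrisation** (characteristic `2`, `λ² + λ + 1 = 0`): `λ^{n+1} + λ^{2n+2} = 0` if `n ≡ 2 (mod 3)`
and `= 1` otherwise. [folklore] -/
theorem rhoSelector_eq {l : R} (hl : l ^ 2 + l + 1 = 0) (n : ℕ) :
    l ^ (n + 1) + l ^ (2 * n + 2) = if n % 3 = 2 then 0 else 1 := by
  have h3 := pow_three_eq_one_of_rho hl
  have h2 : (2 : R) = 0 := CharTwo.two_eq_zero
  have hn : n = 3 * (n / 3) + n % 3 := (Nat.div_add_mod n 3).symm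
  set q := n / 3 with hq
  have e1 : l ^ (n + 1) = l ^ (n % 3 + 1) := by
    conv_lhs => rw [hn]
    rw [show 3 * q + n % 3 + 1 = 3 * q + (n % 3 + 1) by ring, pow_add, pow_mul, h3, one_pow, one_mul]
  have e2 : l ^ (2 * n + 2) = l ^ (2 * (n % 3) + 2) := by
    conv_lhs => rw [hn]
    rw [show 2 * (3 * q + n % 3) + 2 = 3 * (2 * q) + (2 * (n % 3) + 2) by ring, pow_add, pow_mul, h3, one_pow, one_mul]
  rw [e1, e2]
  have hr : n % 3 = 0 ∨ n % 3 = 1 ∨ n % 3 = 2 := by omega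
  rcases hr with hr | hr | hr <;> rw [hr] <;> norm_num
  · linear_combination hl + (-1 : R) * h2
  · linear_combination hl + (-1 : R) * h2 + l * h3
  · linear_combination (l ^ 3 + 2) * h3 + h2

/-- The mirror selector: `λ^{2n+1} + λ^{n+2} = 0` if `n ≡ 1 (mod 3)` and `= 1` otherwise. [folklore] -/
theorem rhoSelector'_eq {l : R} (hl : l ^ 2 + l + 1 = 0) (n : ℕ) :
    l ^ (2 * n + 1) + l ^ (n + 2) = if n % 3 = 1 then 0 else 1 := by
  have h3 := pow_three_eq_one_of_rho hl
  have h2 : (2 : R) = 0 := CharTwo.two_eq_zero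
  have hn : n = 3 * (n / 3) + n % 3 := (Nat.div_add_mod n 3).symm
  set q := n / 3 with hq
  have e1 : l ^ (n + 2) = l ^ (n % 3 + 2) := by
    conv_lhs => rw [hn]
    rw [show 3 * q + n % 3 + 2 = 3 * q + (n % 3 + 2) by ring, pow_add, pow_mul, h3, one_pow, one_mul]
  have e2 : l ^ (2 * n + 1) = l ^ (2 * (n % 3) + 1) := by
    conv_lhs => rw [hn]
    rw [show 2 * (3 * q + n % 3) + 1 = 3 * (2 * q) + (2 * (n % 3) + 1) by ring, pow_add, pow_mul, h3, one_pow, one_mul]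
  rw [e1, e2]
  have hr : n % 3 = 0 ∨ n % 3 = 1 ∨ n % 3 = 2 := by omega
  rcases hr with hr | hr | hr <;> rw [hr] <;> norm_num
  · linear_combination hl + (-1 : R) * h2
  · linear_combination (l ^ 3) * h2
  · linear_combination hl + (-1 : R) * h2 + (l ^ 2 + l) * h3

omit [CharP R 2] in
/-- Coefficients of the `ρ`-symmetrisation with `ζ₃ = λ` acting diagonally (`t ↦ λt` is `PowerSeries.rescale`):
`[tⁿ](λ Φ(λt) + λ² Φ(λ²t)) = (λ^{n+1} + λ^{2n+2}) · [tⁿ]Φ`. [folklore] -/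
theorem coeff_rhoSymm (l : R) (Φ : R⟦X⟧) (n : ℕ) :
    coeff n (C l * rescale l Φ + C (l ^ 2) * rescale (l ^ 2) Φ) = (l ^ (n + 1) + l ^ (2 * n + 2)) * coeff n Φ := by
  rw [map_add, coeff_C_mul, coeff_C_mul, coeff_rescale, coeff_rescale]
  ring

/-- **The symmetrisation kills the residues `n ≡ 2 (mod 3)`** (convention `ζ₃ = λ`): `[tⁿ]S = [tⁿ]Φ` if `n ≢ 2`, else `0`. [folklore] -/
theorem coeff_rhoSymm_eq {l : R} (hl : l ^ 2 + l + 1 = 0) (Φ : R⟦X⟧) (n : ℕ) :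
    coeff n (C l * rescale l Φ + C (l ^ 2) * rescale (l ^ 2) Φ) = if n % 3 = 2 then 0 else coeff n Φ := by
  rw [coeff_rhoSymm, rhoSelector_eq hl]
  split_ifs <;> simp

/-- The other convention (`ζ₃ = λ²`, i.e. `S′ = λ Φ(λ²t) + λ² Φ(λt)`) kills the residues `n ≡ 1 (mod 3)` instead — the card's
convention caveat, made exact. [folklore] -/
theorem coeff_rhoSymm'_eq {l : R} (hl : l ^ 2 + l + 1 = 0) (Φ : R⟦X⟧) (n : ℕ) :
    coeff n (C l * rescale (l ^ 2) Φ + C (l ^ 2) * rescale l Φ) = if n % 3 = 1 then 0 else coeff n Φ := by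
  have h : coeff n (C l * rescale (l ^ 2) Φ + C (l ^ 2) * rescale l Φ) = (l ^ (2 * n + 1) + l ^ (n + 2)) * coeff n Φ := by
    rw [map_add, coeff_C_mul, coeff_C_mul, coeff_rescale, coeff_rescale]
    ring
  rw [h, rhoSelector'_eq hl]
  split_ifs <;> simp

/-- **The level-zero valuation dichotomy `v(S) ∈ {0} ∪ [4, ∞)` (stub J3's algebraic core, convention `ζ₃ = λ`).** If `Φ` carries the
jets `[t⁰]Φ = E`, `[t¹]Φ = E²`, `[t³]Φ = E⁴` (the card's `T₁ = E₀²`, `T₃ = E₀⁴`), then `S = λ Φ(λt) + λ² Φ(λ²t)` has `[t⁰]S = E`,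
`[t¹]S = E²`, `[t²]S = 0`, `[t³]S = E⁴`; hence `E ≠ 0 → [t⁰]S ≠ 0` and `E = 0 → X⁴ ∣ S`. [folklore] -/
theorem rhoSymm_levelZero_dichotomy {l : R} (hl : l ^ 2 + l + 1 = 0) (Φ : R⟦X⟧) {E : R}
    (h0 : coeff 0 Φ = E) (h1 : coeff 1 Φ = E ^ 2) (h3 : coeff 3 Φ = E ^ 4) :
    (E ≠ 0 → coeff 0 (C l * rescale l Φ + C (l ^ 2) * rescale (l ^ 2) Φ) ≠ 0) ∧
      (E = 0 → X ^ 4 ∣ C l * rescale l Φ + C (l ^ 2) * rescale (l ^ 2) Φ) := by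
  constructor
  · intro hE
    rw [coeff_rhoSymm_eq hl]
    simpa [h0] using hE
  · intro hE
    rw [X_pow_dvd_iff]
    intro m hm
    rw [coeff_rhoSymm_eq hl]
    have hm' : m = 0 ∨ m = 1 ∨ m = 2 ∨ m = 3 := by omega
    rcases hm' with rfl | rfl | rfl | rfl
    · simp [h0, hE]
    · simp [h1, hE]
    · simp
    · simp [h3, hE]

/-- Under the other convention (`ζ₃ = λ²`): `[t¹]S′ = 0` always and, with the same jets, `E ≠ 0 → [t⁰]S′ ≠ 0`, `E = 0 → X² ∣ S′`
(the dichotomy degrades to `{0} ∪ [2, ∞)`; `[t²]S′ = [t²]Φ` is NOT forced to vanish). Recorded so that the dictionary's choice is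
checkable against the engine's `v(S₀)` values. [folklore] -/
theorem rhoSymm'_levelZero {l : R} (hl : l ^ 2 + l + 1 = 0) (Φ : R⟦X⟧) {E : R} (h0 : coeff 0 Φ = E) :
    coeff 1 (C l * rescale (l ^ 2) Φ + C (l ^ 2) * rescale l Φ) = 0 ∧
      (E ≠ 0 → coeff 0 (C l * rescale (l ^ 2) Φ + C (l ^ 2) * rescale l Φ) ≠ 0) ∧
      (E = 0 → X ^ 2 ∣ C l * rescale (l ^ 2) Φ + C (l ^ 2) * rescale l Φ) := by
  refine ⟨by rw [coeff_rhoSymm'_eq hl]; simp, fun hE => ?_, fun hE => ?_⟩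
  · rw [coeff_rhoSymm'_eq hl]
    simpa [h0] using hE
  · rw [X_pow_dvd_iff]
    intro m hm
    rw [coeff_rhoSymm'_eq hl]
    have hm' : m = 0 ∨ m = 1 := by omega
    rcases hm' with rfl | rfl
    · simp [h0, hE]
    · simp

end Summit.BirchSwinnertonDyer.BirchSwinnertonDyer.Theorems.SignedMuAtTwo.JetCharacterSums
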